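import Mathlib
import HarnessLib
import Summits.HubbardSuperconductivity.HubbardSuperconductivity.Theorems.KLProgrammeKLRegimeSplitSlotsV17F
import Summits.HubbardSuperconductivity.HubbardSuperconductivity.Theorems.KLProgrammeKLRegimeCountertermMajorantSums
import Summits.HubbardSuperconductivity.HubbardSuperconductivity.Theorems.KLProgrammeKLRegimeCountertermMsThresholds
import Summits.HubbardSuperconductivity.HubbardSuperconductivity.Theorems.KLProgrammeKLRegimeCountertermOneVolumeJS
import Summits.HubbardSuperconductivity.HubbardSuperconductivity.Theorems.KLProgrammeKLRegimeSplitStagePieces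
import Summits.HubbardSuperconductivity.HubbardSuperconductivity.Theorems.KLProgrammeKLRegimeFlowPieceJetsOfReadJets
import Summits.HubbardSuperconductivity.HubbardSuperconductivity.Theorems.KLProgrammeKLRegimeSplitFrameExtFnConst

/-!
# Route `KLProgramme` — gen-7-flow child 2-F `KLRegimeRenormFlowV17F := CountertermP2 klPredsV17F klWindowC`: THE FORWARD INDUCTION, step lemmas abstract
# (plan g16 K3-FLOW RULING F, KL STATUS 2026-08-27 l.2548, S4(b)/S5; seat hubbard-kl-k3c3-p2 — child 2's lineage; consumer pre-read l.2556)

Under the flowing-dispersion bundle `klPredsV17F` (…SplitSlotsV17F: dummy frame `K = 0 ∧ FrameOK`, slots read the DEFINED flow frame `K_n = klFlowFrameU … n`),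
child 2 is no longer a fixed point: `CountertermP2 klPredsV17F klWindowC` says «if the renorm-HISTORY below `n` yields engine ∧ two-leg ∧ split at `n`, then
`RenormFlowAtV17F … n` holds at every `n ≤ n_β`» — a FORWARD induction whose stage-`n` output is
`RenormalisedAtF … K_n R n ∧ FlowPieceJetsAt … R n ∧ FlowGeometryAt … n`.  This file proves it from TWO ABSTRACT STEP INPUTS and nothing else:
* (a) the k = 0 reading fit is internal: `TwoLegReadJetsF … n` at `k = 0` ⇒ `|ν_n(K_n)| ≤ (S₀ + S′₀|U|)|U|16^{−n} ≤ cr·|U|·Λ_n²/klE0` once `S₀ + S′₀|U| ≤ cr/32`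
  (`renormalisedAtF_flow_of_readJets`);
* (b) `hJ` — the JETS STEP `TwoLegReadJetsF … n → FlowPieceJetsAt … (Rf G) n` below a smallness `U ≤ U_J(G, Q)`; abstract in §1–§2, and DISCHARGED in §3
  from k3c3-p3 g5's scheme-generic p524080 (`…FlowPieceJetsOfReadJets`, `norm_iteratedFDeriv_evalM_jacksonFrame_klFrameExtFn_le_pieceBar_GQ`) at
  `K := K_n`, `d := klFlowDeg n`, with the explicit `G`-only table `Gfr j := 2·(curveExtC X G.S j + 1)` (`X` the cutoff-derivative constant of
  `exists_norm_iteratedFDeriv_salmhoferCutoff_le_all 4`) and the threshold `U ≤ 1/(Σ_{j<5} curveExtC X Q.S' j + 1)` (`flowPieceJetsAt_of_readJetsF_at`);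
* (c) the GEOMETRY STEP is internal (Lemma 2.1 per scale = [tree] `geomConstants_of_pieces`, …SplitStagePieces): the pieces' jets at `m ≤ n` and the three
  low-order allowance sums ([tree] `allowanceSums_thresholds`, generic in `R`) give `FlowGeometryAt … n` (`flowGeometry_of_pieceJets`);
assembled by strong induction on `n` at each volume separately (no volume transfer: the frames are per volume) into
**`countertermP2_klPredsV17F_of_jetsStep`** `: (Rf : GeoConsts → RenConsts) → (WF2, cr-fit) → hJ → CountertermP2 klPredsV17F klWindowC`, whence the
UNCONDITIONAL **`countertermP2_klPredsV17F_holds : CountertermP2 klPredsV17F klWindowC`** (§3) at the package `G ↦ ⟨32·(G.S 0 + 1) + 32, 1, 2·(curveExtC X G.S · + 1)⟩`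
— the text of the gen-7-flow child 2-F, closed.
Proofs only; nothing about the Hubbard model is asserted beyond the hypotheses; nothing here asserts superconductivity.
-/

noncomputable section

namespace Summit.HubbardSuperconductivity.HubbardSuperconductivity.Theorems.KLRegimeSplit

set_option linter.dupNamespace false -- summit = problem name (single-conjunct summit), D-0017

open Real Finset
open Literature.MathematicalPhysics.QuantumLattice Literature.Probability.LatticeModels
open Summit.HubbardSuperconductivity.HubbardSuperconductivity.Theorems.KLProgrammeLegKernels
open Summit.HubbardSuperconductivity.HubbardSuperconductivity.Theorems.DispersionFlow

section Steps

variable {L M : ℕ} [NeZero L] [NeZero M] {G : GeoConsts} {Q : EngConsts} {R : RenConsts} {β U μ : ℝ} {n : ℕ}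

/-- **(a) the renormalisation of the flow frame at its own scale from the reading jets at `k = 0`**: `TwoLegReadJetsF … n` and the fit
`G.S 0 + Q.S' 0 · |U| ≤ R.cr / 32` give `RenormalisedAtF … (klFlowFrameU … n) R n`. -/
theorem renormalisedAtF_flow_of_readJets (hJets : TwoLegReadJetsF L M G Q β U μ n) (hfit : G.S 0 + Q.S' 0 * |U| ≤ R.cr / 32) :
    RenormalisedAtF L M β U μ (klFlowFrameU L M β U μ n) R n := by
  intro θ
  have h0 := hJets.2 0 (by norm_num) θ
  rw [iteratedDeriv_zero, curveJetBar_eq_twoLegBar, ct_twoLegBar_zero_eq] at h0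
  rw [ct_tol_eq]
  refine h0.trans ?_
  have hx : 0 ≤ |U| * ((16 : ℝ) ^ n)⁻¹ := by positivity
  calc (G.S 0 + Q.S' 0 * |U|) * |U| * ((16 : ℝ) ^ n)⁻¹ = (G.S 0 + Q.S' 0 * |U|) * (|U| * ((16 : ℝ) ^ n)⁻¹) := by ring
    _ ≤ R.cr / 32 * (|U| * ((16 : ℝ) ^ n)⁻¹) := mul_le_mul_of_nonneg_right hfit hx
    _ = R.cr * |U| / 32 * ((16 : ℝ) ^ n)⁻¹ := by ring

/-- **(c) the geometry step from the pieces' jets**: if every flow piece `m ≤ n` has admissible jets and the three low-order allowance sums over `m ≤ n`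
are small, then `ε − μ − K_{n+1}` has the `GeomConstants` of `FrameOK` (`μ ∈ klWindowC`). -/
theorem flowGeometry_of_pieceJets (hμ : μ ∈ klWindowC) (hR : ∀ j, 0 ≤ R.Gfr j)
    (hJ : ∀ m ≤ n, FlowPieceJetsAt L M β U μ R m)
    (h0 : ∑ m ∈ range (n + 1), R.Gfr 0 * uPow 0 U * (4 : ℝ) ^ (((0 : ℤ) - 2) * m) ≤ 3 / 80)
    (h1 : ∑ m ∈ range (n + 1), R.Gfr 1 * uPow 1 U * (4 : ℝ) ^ (((1 : ℤ) - 2) * m) ≤ 1 / 2000)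
    (h2 : ∑ m ∈ range (n + 1), ∑ j ∈ range 3, R.Gfr j * uPow j U * (4 : ℝ) ^ (((j : ℤ) - 2) * m) ≤ 1 / 100) :
    FlowGeometryAt L M β U μ n := by
  have hμ' : μ ∈ Set.Icc (-1.05 : ℝ) (-0.15) := hμ
  set bd : ℕ → ℕ → ℝ := fun j m => R.Gfr j * uPow j U * (4 : ℝ) ^ (((j : ℤ) - 2) * m) with hbd_def
  have hbd : ∀ j m, 0 ≤ bd j m := fun j m =>
    mul_nonneg (mul_nonneg (hR j) (uPow_nonneg j U)) (zpow_nonneg (by norm_num) _)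
  have hsum : frameShift (klFlowFrameU L M β U μ (n + 1)) = fun q => ∑ m ∈ range (n + 1), evalM (klFlowPiece L M β U μ m) q := by
    funext q
    rw [frameShift_eq_neg_evalM]
    show -evalM (klFlowFrameU L M β U μ (n + 1)) q = _
    rw [evalM_apply, eval_klFlowFrameU, neg_neg]
    exact sum_congr rfl fun m _ => (evalM_apply _ _).symm
  exact geomConstants_of_pieces hμ' hbd hsum (fun m hm j hj q => hJ m hm j (hj.trans (by norm_num)) q) h0 h1 h2

end Steps

/-! ## The forward induction -/

/-- **CHILD 2-F OF THE FLOWING-DISPERSION SPLIT, FROM THE JETS STEP.**  Let `Rf G` be a renormalisation package depending on `G` only, well formed with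
positive tolerances, whose mismatch constant absorbs the k = 0 reading (`G.S 0 + 1 ≤ (Rf G).cr / 32`), and let `hJ` be the jets step (the flow piece
`klFlowPiece … n` — Jackson mean of the tube extension of the cumulative reading — has the jets of an admissible `(Rf G)`-piece whenever the reading has
the (E3a-F) jets, below a smallness `U_J(G, Q)`).  Then `CountertermP2 klPredsV17F klWindowC`. -/
theorem countertermP2_klPredsV17F_of_jetsStep (Rf : GeoConsts → RenConsts)
    (hRf : ∀ G : GeoConsts, G.WF → (Rf G).WF2)
    (hcr : ∀ G : GeoConsts, G.WF → G.S 0 + 1 ≤ (Rf G).cr / 32)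
    (hJ : ∀ (G : GeoConsts) (Q : EngConsts), G.WF → Q.WF → ∃ UJ : ℝ, 0 < UJ ∧
      ∀ (L M : ℕ) [NeZero L] [NeZero M] (β U μ : ℝ) (n : ℕ), 0 < U → U ≤ UJ → klBetaMin ≤ β → μ ∈ klWindowC →
        TwoLegReadJetsF L M G Q β U μ n → FlowPieceJetsAt L M β U μ (Rf G) n) :
    CountertermP2 klPredsV17F klWindowC := by
  intro G P hG _hP
  refine ⟨Rf G, hRf G hG, fun Q hQ => ?_⟩
  have hR : ∀ j, 0 ≤ (Rf G).Gfr j := (hRf G hG).1.2.2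
  have hS'0 : 0 ≤ Q.S' 0 := hQ.2.2.2.2.1 0
  -- thresholds: the allowance sums (c₂, U₂), the jets step (UJ), the reading fit (U ≤ 1/(S′₀+1))
  obtain ⟨c₂, hc₂, U₂, hU₂, hsums⟩ := allowanceSums_thresholds hR
  obtain ⟨UJ, hUJ, hJ'⟩ := hJ G Q hG hQ
  refine ⟨c₂, hc₂, fun c hc0 hcle => ⟨min U₂ (min UJ (1 / (Q.S' 0 + 1))), lt_min hU₂ (lt_min hUJ (by positivity)), ?_⟩⟩
  intro μ hμ U hU hUle β hβ hβc Lh Mh hhyp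
  have hU2 : U ≤ U₂ := hUle.trans (min_le_left _ _)
  have hUJ' : U ≤ UJ := hUle.trans ((min_le_right _ _).trans (min_le_left _ _))
  have hUS : U ≤ 1 / (Q.S' 0 + 1) := hUle.trans ((min_le_right _ _).trans (min_le_right _ _))
  obtain ⟨h0, h1, h2⟩ := hsums c U β hc0.le hcle hU hU2 hβ hβc
  have hμw : μ ∈ Set.Icc (-1.05 : ℝ) (-0.15) := hμ
  -- the reading fit `S₀ + S′₀|U| ≤ cr/32` from `U ≤ 1/(S′₀+1)`
  have hfit : G.S 0 + Q.S' 0 * |U| ≤ (Rf G).cr / 32 := by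
    have habs : |U| = U := abs_of_pos hU
    have h1' : Q.S' 0 * U ≤ 1 := by
      have := mul_le_mul_of_nonneg_left hUS hS'0
      have hS1 : Q.S' 0 * (1 / (Q.S' 0 + 1)) ≤ 1 := by
        rw [mul_one_div, div_le_one (by positivity)]; linarith
      exact this.trans hS1
    rw [habs]; linarith [hcr G hG]
  -- the dummy frame: `0`, admissible by the allowance sums
  have hzero : FrameOK (Rf G) U (nScales β) μ (0 : TrigPolyC4v) := frameOK_zero_of_sums hR hμw h0 h1 h2
  refine ⟨0, ⟨rfl, hzero⟩, Lh, Mh, fun L M _ _ hL hM => ?_⟩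
  -- strong induction on the scale, at the volume `(L, M)`
  have hmain : ∀ n : ℕ, n ≤ nScales β → RenormFlowAtV17F L M β U μ (Rf G) n := by
    intro n
    induction n using Nat.strong_induction_on with
    | _ n ih =>
      intro hn
      have hhist : ∀ j < n, klPredsV17F.renorm L M β U μ (0 : TrigPolyC4v) (Rf G) j :=
        fun j hj => ih j hj ((le_of_lt hj).trans hn)
      obtain ⟨-, htwo, -⟩ := hhyp 0 ⟨rfl, hzero⟩ L M hL hM n hn hhist
      have hjets : TwoLegReadJetsF L M G Q β U μ n := htwo.1
      -- (b) the jets of the new piece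
      have hPn : FlowPieceJetsAt L M β U μ (Rf G) n := hJ' L M β U μ n hU hUJ' hβ hμ hjets
      have hPall : ∀ m ≤ n, FlowPieceJetsAt L M β U μ (Rf G) m := by
        intro m hm
        rcases Nat.lt_or_ge m n with hlt | hge
        · exact (ih m hlt ((le_of_lt hlt).trans hn)).2.1
        · have : m = n := le_antisymm hm hge
          rw [this]; exact hPn
      -- (c) the geometry of the next band, from the pieces `m ≤ n` and the sums over `m ≤ n ≤ n_β`
      have hsub : range (n + 1) ⊆ range (nScales β + 1) := range_mono (show n + 1 ≤ nScales β + 1 by omega)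
      have hterm0 : ∀ m, 0 ≤ (Rf G).Gfr 0 * uPow 0 U * (4 : ℝ) ^ (((0 : ℤ) - 2) * m) := fun m =>
        mul_nonneg (mul_nonneg (hR 0) (uPow_nonneg 0 U)) (zpow_nonneg (by norm_num) _)
      have hterm1 : ∀ m, 0 ≤ (Rf G).Gfr 1 * uPow 1 U * (4 : ℝ) ^ (((1 : ℤ) - 2) * m) := fun m =>
        mul_nonneg (mul_nonneg (hR 1) (uPow_nonneg 1 U)) (zpow_nonneg (by norm_num) _)
      have hterm2 : ∀ m, 0 ≤ ∑ j ∈ range 3, (Rf G).Gfr j * uPow j U * (4 : ℝ) ^ (((j : ℤ) - 2) * m) := fun m =>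
        sum_nonneg fun j _ => mul_nonneg (mul_nonneg (hR j) (uPow_nonneg j U)) (zpow_nonneg (by norm_num) _)
      have h0n := (sum_le_sum_of_subset_of_nonneg hsub fun m _ _ => hterm0 m).trans h0
      have h1n := (sum_le_sum_of_subset_of_nonneg hsub fun m _ _ => hterm1 m).trans h1
      have h2n := (sum_le_sum_of_subset_of_nonneg hsub fun m _ _ => hterm2 m).trans h2
      have hgeo : FlowGeometryAt L M β U μ n := flowGeometry_of_pieceJets hμ hR hPall h0n h1n h2n
      exact ⟨renormalisedAtF_flow_of_readJets hjets hfit, hPn, hgeo⟩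
  intro n hn
  exact hmain n hn

/-! ## §3 The jets step discharged (p524080 keyed to the flow) and the unconditional closer -/

/-- **The jets step at a given cutoff constant `X`** (`1 ≤ X`, `‖Dˡχ₂‖ ≤ X` for `l ≤ 4`): for well-formed `G`, `Q` there is `UJ > 0` (depending on `Q`, `X`)
such that for `0 < U ≤ UJ` the cumulative-reading jets `TwoLegReadJetsF L M G Q β U μ n` give the piece jets `FlowPieceJetsAt` at the `G`-only package
`⟨32·(G.S 0 + 1) + 32, 1, fun j => 2·(curveExtC X G.S j + 1)⟩`. -/
theorem flowPieceJetsAt_of_readJetsF_at (X : ℝ) (hX1 : 1 ≤ X) (hX : ∀ l ≤ 4, ∀ x : ℝ, ‖iteratedFDeriv ℝ l salmhoferCutoff x‖ ≤ X)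
    (G : GeoConsts) (Q : EngConsts) (hG : G.WF) (hQ : Q.WF) :
    ∃ UJ : ℝ, 0 < UJ ∧ ∀ (L M : ℕ) [NeZero L] [NeZero M] (β U μ : ℝ) (n : ℕ), 0 < U → U ≤ UJ → klBetaMin ≤ β → μ ∈ klWindowC →
      TwoLegReadJetsF L M G Q β U μ n →
        FlowPieceJetsAt L M β U μ ⟨32 * (G.S 0 + 1) + 32, 1, fun j => 2 * (curveExtC X G.S j + 1)⟩ n := by
  have hX0 : 0 ≤ X := by linarith
  have hS : ∀ j, 0 ≤ G.S j := hG.2.2.2.2.2.2.2.2.2.2.2.2.2.2.2.2.2.1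
  have hS' : ∀ j, 0 ≤ Q.S' j := hQ.2.2.2.2.1
  have hsum0 : 0 ≤ ∑ i ∈ range 5, curveExtC X Q.S' i := sum_nonneg fun i _ => curveExtC_nonneg hX0 hS' i
  refine ⟨1 / (∑ i ∈ range 5, curveExtC X Q.S' i + 1), by positivity, ?_⟩
  intro L M _ _ β U μ n hU0 hUJ _hβ hμ hJets j hj q
  have hfit : ∀ j ≤ 4, curveExtC X G.S j + curveExtC X Q.S' j * |U| ≤
      (⟨32 * (G.S 0 + 1) + 32, 1, fun j => 2 * (curveExtC X G.S j + 1)⟩ : RenConsts).Gfr j := by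
    intro j hj
    show _ ≤ 2 * (curveExtC X G.S j + 1)
    have hc : 0 ≤ curveExtC X G.S j := curveExtC_nonneg hX0 hS j
    have hle : curveExtC X Q.S' j ≤ ∑ i ∈ range 5, curveExtC X Q.S' i :=
      single_le_sum (f := fun i => curveExtC X Q.S' i) (fun i _ => curveExtC_nonneg hX0 hS' i) (mem_range.mpr (by omega))
    have hU : |U| ≤ 1 / (∑ i ∈ range 5, curveExtC X Q.S' i + 1) := by rwa [abs_of_pos hU0]
    have h1 : curveExtC X Q.S' j * |U| ≤ 1 :=
      calc curveExtC X Q.S' j * |U|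
          ≤ (∑ i ∈ range 5, curveExtC X Q.S' i) * (1 / (∑ i ∈ range 5, curveExtC X Q.S' i + 1)) :=
            mul_le_mul hle hU (abs_nonneg U) hsum0
        _ ≤ 1 := by
            rw [mul_one_div]
            exact div_le_one_of_le₀ (by linarith) (by linarith)
    linarith
  exact norm_iteratedFDeriv_evalM_jacksonFrame_klFrameExtFn_le_pieceBar_GQ hS hS' hμ hJets.1 hJets.2 hX hfit (klFlowDeg n) hj q

/-- **Child 2-F of the gen-7-flow re-split CLOSES**: `CountertermP2 klPredsV17F klWindowC` — the forward induction
`countertermP2_klPredsV17F_of_jetsStep` at the package `G ↦ ⟨32·(G.S 0 + 1) + 32, 1, 2·(curveExtC X G.S · + 1)⟩`, `X` the cutoff-derivative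
constant of `exists_norm_iteratedFDeriv_salmhoferCutoff_le_all 4`, with the jets step `flowPieceJetsAt_of_readJetsF_at`. -/
theorem countertermP2_klPredsV17F_holds : CountertermP2 klPredsV17F klWindowC := by
  obtain ⟨X, hX1, hX⟩ := exists_norm_iteratedFDeriv_salmhoferCutoff_le_all 4
  have hX0 : 0 ≤ X := by linarith
  refine countertermP2_klPredsV17F_of_jetsStep (fun G => ⟨32 * (G.S 0 + 1) + 32, 1, fun j => 2 * (curveExtC X G.S j + 1)⟩)
    (fun G hG => ?_) (fun G _ => ?_) (fun G Q hG hQ => flowPieceJetsAt_of_readJetsF_at X hX1 hX G Q hG hQ)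
  · have hS : ∀ j, 0 ≤ G.S j := hG.2.2.2.2.2.2.2.2.2.2.2.2.2.2.2.2.2.1
    refine ⟨⟨?_, by norm_num, fun j => ?_⟩, ?_, by norm_num⟩
    · show (0 : ℝ) ≤ 32 * (G.S 0 + 1) + 32
      have := hS 0; positivity
    · show (0 : ℝ) ≤ 2 * (curveExtC X G.S j + 1)
      have := curveExtC_nonneg hX0 hS j; positivity
    · show (0 : ℝ) < 32 * (G.S 0 + 1) + 32
      have := hS 0; positivity
  · show G.S 0 + 1 ≤ (32 * (G.S 0 + 1) + 32) / 32
    linarith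

end Summit.HubbardSuperconductivity.HubbardSuperconductivity.Theorems.KLRegimeSplit

end
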